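import Mathlib
import Literature.Computability.Complexity.CNF
import Literature.Computability.MetaComplexity.Resolution

/-!
# Sketch — crux-ideate stmt-PneNP-9818 (RegularResolutionRung), ideator 1, round 1

First lemmas of the three levers (A: sound-path bottleneck, B: indelible zero-banks,
shared transfer C⁺ = two-sided bi-dense regular lower bound) stated over existing
declarations.  Nothing here is proved; everything must elaborate.
-/

namespace Summit.PneNP.PneNP.Cruxes.RegularResolutionRung.Sketch

open Finset

variable {m : ℕ}

/-- ordered edge count between two vertex sets (LPRT Def. 10: `d(A,B) = e(A,B)/(|A||B|)`). -/
def edgeCount (H : SimpleGraph (Fin m)) [DecidableRel H.Adj] (A B : Finset (Fin m)) : ℕ :=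
  ((A ×ˢ B).filter fun p => H.Adj p.1 p.2).card

/-- neighbourhood of `w` inside `X`. -/
def nbhdIn (H : SimpleGraph (Fin m)) [DecidableRel H.Adj] (w : Fin m) (X : Finset (Fin m)) :
    Finset (Fin m) :=
  X.filter fun v => H.Adj w v

/-- common neighbourhood of the finite set `U` inside `X` (ABdRLNR's `N̂_X(U)`). -/
def commonNbhdIn (H : SimpleGraph (Fin m)) [DecidableRel H.Adj] (U X : Finset (Fin m)) :
    Finset (Fin m) :=
  X.filter fun v => ∀ u ∈ U, H.Adj u v

/-- lower bi-density at scale `M` with density `δ` (the half of Prömel–Rödl used by LPRT). -/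
def LowerBiDense (H : SimpleGraph (Fin m)) [DecidableRel H.Adj] (M : ℕ) (δ : ℝ) : Prop :=
  ∀ A B : Finset (Fin m), M ≤ A.card → M ≤ B.card →
    δ * A.card * B.card ≤ (edgeCount H A B : ℝ)

/-- upper bi-density at scale `M` (the half NOT used by LPRT; it is what separates Ramsey
cores from the complete `(k-1)`-partite counterexample). -/
def UpperBiDense (H : SimpleGraph (Fin m)) [DecidableRel H.Adj] (M : ℕ) (δ : ℝ) : Prop :=
  ∀ A B : Finset (Fin m), M ≤ A.card → M ≤ B.card →
    (edgeCount H A B : ℝ) ≤ (1 - δ) * A.card * B.card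

/-! ### Lever A — sound paths -/

/-- **JunkSetSmall** (shared brick): under lower bi-density, for every reference set `Y` of
size `≥ M`, fewer than `M` vertices have `< δ|Y|` neighbours in `Y`.  This is what the
Adversary-steered path distribution vetoes, and it bounds the total vetoed set by
`(#reference sets)·M`. -/
def JunkSetSmall : Prop :=
  ∀ (m M : ℕ) (δ : ℝ) (H : SimpleGraph (Fin m)) [DecidableRel H.Adj],
    0 < M → LowerBiDense H M δ → ∀ Y : Finset (Fin m), M ≤ Y.card →
      (univ.filter fun w => ((nbhdIn H w Y).card : ℝ) < δ * Y.card).card < M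

/-- **SoundChainBound** (first lemma of Lever A): along a *sound* acceptance sequence
`us` (each new vertex keeps a `δ`-fraction of the current common neighbourhood inside the
block `X`, as long as that set is still `≥ M`), the common neighbourhood of the whole chain
inside `X` is at least `δ^{|us|}·|X|`.  This is the replacement for ABdRLNR property 1 in
the `α`-good-pair version of their Lemma 6.6 (witness sets live inside the accepted set). -/
def SoundChainBound : Prop :=
  ∀ (m M : ℕ) (δ : ℝ) (H : SimpleGraph (Fin m)) [DecidableRel H.Adj] (X : Finset (Fin m))
    (us : List (Fin m)),
    0 < δ → δ ≤ 1 →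
    (∀ j < us.length, ∀ hj : j < us.length,
      (M : ℝ) ≤ ((commonNbhdIn H (us.take j).toFinset X).card : ℝ) →
      δ * (commonNbhdIn H (us.take j).toFinset X).card ≤
        ((nbhdIn H (us.get ⟨j, hj⟩) (commonNbhdIn H (us.take j).toFinset X)).card : ℝ)) →
    (M : ℝ) ≤ δ ^ us.length * X.card →
    δ ^ us.length * X.card ≤ ((commonNbhdIn H us.toFinset X).card : ℝ)

/-! ### Lever B — indelible zero-banks -/

/-- **ShadowPinning** (first lemma of Lever B): under upper bi-density at scale `M`, a set
`X` of size `≥ M` is contained in the neighbourhoods of fewer than `M` vertices; robust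
form with `⌊δ|X|/2⌋` exceptions.  On a path ending at the clique axiom of block `i*`, the
unbanked set `U(c)` of a node equals (up to coins + vetoes) the common block-neighbourhood of
every accepted vertex whose shadow has been fully banked, so those vertices are pinned to
`< M` node-determined candidates. -/
def ShadowPinning : Prop :=
  ∀ (m M : ℕ) (δ : ℝ) (H : SimpleGraph (Fin m)) [DecidableRel H.Adj],
    0 < M → 0 < δ → UpperBiDense H M δ → ∀ X : Finset (Fin m), M ≤ X.card →
      (univ.filter fun w => ((X \ nbhdIn H w X).card : ℝ) ≤ δ * X.card / 2).card < M

/-! ### Shared transfer: Prömel–Rödl core (named fact to vendor) and the bi-dense target C⁺ -/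

/-- **PromelRodlCore** — LPRT Lemma 11 ([PromelRodl1999]; arXiv:1303.3166 Lemma 11) at the
exact Erdős threshold: every `⌈2 log₂ n⌉`-Ramsey graph has a core `S`, `|S| ≥ n^{3/4}`, that
is two-sided bi-dense at scale `|S|^{1-β}`.  UNPROVED in the tree (Literature fact wanted). -/
def PromelRodlCore : Prop :=
  ∃ β : ℝ, 0 < β ∧ ∃ δ : ℝ, 0 < δ ∧ ∃ n₀ : ℕ, ∀ n ≥ n₀, ∀ (G : SimpleGraph (Fin n))
    [DecidableRel G.Adj],
    G.CliqueFree (Nat.clog 2 (n ^ 2)) → Gᶜ.CliqueFree (Nat.clog 2 (n ^ 2)) →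
    ∃ S : Finset (Fin n), (n : ℝ) ^ (3 / 4 : ℝ) ≤ S.card ∧
      ∀ A B : Finset (Fin n), A ⊆ S → B ⊆ S →
        (S.card : ℝ) ^ (1 - β) ≤ A.card → (S.card : ℝ) ^ (1 - β) ≤ B.card →
        δ * A.card * B.card ≤ (edgeCount G A B : ℝ) ∧
          (edgeCount G A B : ℝ) ≤ (1 - δ) * A.card * B.card

/-- the crux's unary clique CNF `Clique(H,k)` (same clause lists as in the route file, with
`k` a free parameter instead of `Nat.clog 2 (n^2)`). -/
def cliqueCNF (n k : ℕ) (adj : Fin n → Fin n → Bool) :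
    Literature.Computability.Complexity.CNF ℕ :=
  ((List.range k).map fun i => (List.finRange n).map fun v => (i * n + (v : ℕ), true)) ++
  ((List.range k).flatMap fun i => (List.finRange n).flatMap fun u =>
    (List.finRange n).flatMap fun v =>
      if u < v then [[(i * n + (u : ℕ), false), (i * n + (v : ℕ), false)]] else []) ++
  ((List.range k).flatMap fun i => (List.range k).flatMap fun j =>
    (List.finRange n).flatMap fun u => (List.finRange n).flatMap fun v =>
      if i ≠ j ∧ adj u v = false then [[(i * n + (u : ℕ), false), (j * n + (v : ℕ), false)]]
      else [])

/-- **BiDenseRegularLB** — the transfer target C⁺ (deterministic pseudo-random form of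
ABdRLNR §9's first question, with the WEAKEST hypothesis that can work: two-sided bi-density
at polynomial scale; one-sided fails by the `(k-1)`-partite example).  With `PromelRodlCore`
and restriction-monotonicity of regular refutations under induced subgraphs it implies the
crux (indeed hardness for `G` AND `Ḡ`). -/
def BiDenseRegularLB : Prop :=
  ∀ β δ C : ℝ, 0 < β → 0 < δ → 0 < C → ∃ ε : ℝ, 0 < ε ∧ ∃ m₀ : ℕ, ∀ m ≥ m₀,
    ∀ (H : SimpleGraph (Fin m)) [DecidableRel H.Adj],
    LowerBiDense H ⌈(m : ℝ) ^ (1 - β)⌉₊ δ → UpperBiDense H ⌈(m : ℝ) ^ (1 - β)⌉₊ δ →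
    ∀ k : ℕ, (k : ℝ) ≤ C * Real.logb 2 m →
    ∀ π : List (Literature.Computability.MetaComplexity.ResLine ℕ),
      Literature.Computability.MetaComplexity.IsResRefutation
          (cliqueCNF m k fun u v => decide (H.Adj u v)) π →
      Literature.Computability.MetaComplexity.IsRegular π →
      (m : ℝ) ^ (ε * Real.logb 2 m) ≤ (π.length : ℝ)

/-- **RestrictionMonotone** — the normal-form tool used by both levers (and the one-width
reduction of Lever B): zeroing the variables of the vertices outside `A` turns a regular
refutation of `Clique(G,k)` into one of `Clique(G[A],k)` that is no longer than it (stated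
with an explicit re-indexing `e : Fin a ↪ Fin n` of the induced subgraph). -/
def RestrictionMonotone : Prop :=
  ∀ (n a k : ℕ) (G : SimpleGraph (Fin n)) [DecidableRel G.Adj] (e : Fin a ↪ Fin n)
    (π : List (Literature.Computability.MetaComplexity.ResLine ℕ)),
    Literature.Computability.MetaComplexity.IsResRefutation
        (cliqueCNF n k fun u v => decide (G.Adj u v)) π →
    Literature.Computability.MetaComplexity.IsRegular π →
    ∃ π' : List (Literature.Computability.MetaComplexity.ResLine ℕ),
      Literature.Computability.MetaComplexity.IsResRefutation
          (cliqueCNF a k fun u v => decide (G.Adj (e u) (e v))) π' ∧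
      Literature.Computability.MetaComplexity.IsRegular π' ∧ π'.length ≤ π.length


/-! ### Lever C — dependent-random-choice self-rich core -/

/-- **DRCSelfRichCore** (first lemma of Lever C): every exact-threshold Ramsey graph contains
a polynomial-size vertex set `S` in which EVERY set of at most `c log₂ n` vertices has at
least `|S|^{1-γ}` common neighbours INSIDE `S` (ABdRLNR property 1 restored verbatim for all
small sets, so that their Claim 6.5 / Lemma 6.6 / Case 1 run unchanged with the oblivious
path distribution on `Clique(G[S],k)` with random balanced blocks).  Tool: dependent random
choice (`S ⊆ N̂(T₀)` for a random `t`-set `T₀`) + Erdős–Szemerédi density of all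
polynomial-size induced subgraphs of a Ramsey graph; the self-containment (common neighbours
in `S`, not in `V`) is the new point.  By symmetry the same holds in `Gᶜ`. -/
def DRCSelfRichCore : Prop :=
  ∃ c : ℝ, 0 < c ∧ ∃ γ : ℝ, 0 < γ ∧ γ < 1 ∧ ∃ γ' : ℝ, 0 < γ' ∧ ∃ n₀ : ℕ, ∀ n ≥ n₀,
    ∀ (G : SimpleGraph (Fin n)) [DecidableRel G.Adj],
    G.CliqueFree (Nat.clog 2 (n ^ 2)) → Gᶜ.CliqueFree (Nat.clog 2 (n ^ 2)) →
    ∃ S : Finset (Fin n), (n : ℝ) ^ γ' ≤ S.card ∧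
      ∀ R : Finset (Fin n), R ⊆ S → (R.card : ℝ) ≤ c * Real.logb 2 n →
        (S.card : ℝ) ^ (1 - γ) ≤ ((commonNbhdIn G R S).card : ℝ)

end Summit.PneNP.PneNP.Cruxes.RegularResolutionRung.Sketch
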